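import Summits.AtomisticToContinuum.Crystallization.Theorems.ChartedZeroExcessLayeredLatticeLiouvilleVC

/-!
# Zero-excess layered lattice Liouville — part VD (lens-2 g57, node «MixedSup» 1/2): the discrete SUP BOUND on the box `[0, N]³` from MIXED differences
(dominating mixed smoothness — at most ONE difference per axis), configuration-free.

`cubeSupBound` (abstract, on the box `[0, N]³ ⊆ ℕ³`): for `h : ℕ → ℕ → ℕ → E3` and every point of the box,
`(N+1)³ ‖h i j k‖² ≤ 8 Σ_{S ⊆ {1,2,3}} ((N+1)N)^{|S|} Σ_box ‖Δ^S h‖²`, the three-fold tensorisation of the one-dimensional bound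
`(N+1)‖f u‖² ≤ 2 Σ_v ‖f v‖² + 2(N+1)N Σ_w ‖f (w+1) − f w‖²` (`lineSupBound`: telescoping Cauchy–Schwarz + averaging over the line).
The lattice form on index cubes (chart `cubePt`, peeling of the cross-layer difference into energies of IN-PLANE iterates) is part VE.  This is the
embedding that converts the tangential `H^k` ladder of part VC into POINTWISE bounds with only one cross-layer difference (the laminate has no second
cross-layer regularity).  Bricks of (LD) `LinearExcessDecayZ`; nothing of the column is re-typed, nothing here is an item.
-/

noncomputable section

open scoped BigOperators InnerProductSpace RealInnerProductSpace
open MeasureTheory Set Metric Filter Topology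
open Summit.AtomisticToContinuum.Crystallization.Theorems.ChartedPlanarOrderRigidityDoor (E3 IsNash atomsIn)
open Summit.AtomisticToContinuum.Crystallization.Theorems.ChartedPlanarOrderDensityDichotomy (μS IsSep nK nK_nonneg)
open Summit.AtomisticToContinuum.Crystallization.Theorems.ChartedPlanarOrderDoorLayered (Layered layeredHom_eq_layered)

namespace Summit.AtomisticToContinuum.Crystallization.Theorems.ChartedZeroExcessLayeredLatticeLiouville

section MixedSup

/-! ### VD.1  One dimension: telescoping and averaging over a line -/

/-- Auxiliary step (`norm add sq le two`). [formal bookkeeping] -/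
theorem norm_add_sq_le_two (A B : E3) : ‖A + B‖ ^ 2 ≤ 2 * ‖A‖ ^ 2 + 2 * ‖B‖ ^ 2 := by
  have h1 : ‖A + B‖ ^ 2 ≤ (‖A‖ + ‖B‖) ^ 2 := pow_le_pow_left₀ (norm_nonneg _) (norm_add_le _ _) 2
  nlinarith [sq_nonneg (‖A‖ - ‖B‖)]

/-- telescoping Cauchy–Schwarz on `ℕ`: `‖f (p + m) − f p‖² ≤ m · Σ_{w < m} ‖f (p + (w+1)) − f (p + w)‖²`. [this file, g57] -/
theorem norm_sub_sq_le_telescope (f : ℕ → E3) (p m : ℕ) :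
    ‖f (p + m) - f p‖ ^ 2 ≤ m * ∑ w ∈ Finset.range m, ‖f (p + (w + 1)) - f (p + w)‖ ^ 2 := by
  have htel : f (p + m) - f p = ∑ w ∈ Finset.range m, (f (p + (w + 1)) - f (p + w)) := by
    have := Finset.sum_range_sub (fun w => f (p + w)) m
    simp only [add_zero] at this
    exact this.symm
  rw [htel]
  calc ‖∑ w ∈ Finset.range m, (f (p + (w + 1)) - f (p + w))‖ ^ 2
      ≤ (∑ w ∈ Finset.range m, ‖f (p + (w + 1)) - f (p + w)‖) ^ 2 :=
        pow_le_pow_left₀ (norm_nonneg _) (norm_sum_le _ _) 2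
    _ ≤ (Finset.range m).card * ∑ w ∈ Finset.range m, ‖f (p + (w + 1)) - f (p + w)‖ ^ 2 := sq_sum_le_card_mul_sum_sq
    _ = m * ∑ w ∈ Finset.range m, ‖f (p + (w + 1)) - f (p + w)‖ ^ 2 := by rw [Finset.card_range]

/-- between any two points of `[0, N]`: `‖f u − f v‖² ≤ N · Σ_{w < N} ‖f (w+1) − f w‖²`. [this file, g57] -/
theorem norm_sub_sq_le_of_le (f : ℕ → E3) {N u v : ℕ} (hu : u ≤ N) (hv : v ≤ N) :
    ‖f u - f v‖ ^ 2 ≤ N * ∑ w ∈ Finset.range N, ‖f (w + 1) - f w‖ ^ 2 := by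
  wlog huv : v ≤ u generalizing u v
  · rw [norm_sub_rev]
    exact this hv hu (not_le.mp huv).le
  obtain ⟨m, rfl⟩ := Nat.exists_eq_add_of_le huv
  have h1 := norm_sub_sq_le_telescope f v m
  have hmN : (m : ℝ) ≤ N := by exact_mod_cast (show m ≤ N by omega)
  have h2 : ∑ w ∈ Finset.range m, ‖f (v + (w + 1)) - f (v + w)‖ ^ 2 ≤ ∑ w ∈ Finset.range N, ‖f (w + 1) - f w‖ ^ 2 := by
    have hinj : Set.InjOn (fun w : ℕ => v + w) ↑(Finset.range m) := fun x _ y _ h => by simpa using h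
    have e1 : ∑ w ∈ Finset.range m, ‖f (v + (w + 1)) - f (v + w)‖ ^ 2 =
        ∑ w ∈ (Finset.range m).image (fun w => v + w), ‖f (w + 1) - f w‖ ^ 2 := by
      rw [Finset.sum_image hinj]
      exact Finset.sum_congr rfl fun w _ => by rw [add_assoc]
    rw [e1]
    refine Finset.sum_le_sum_of_subset_of_nonneg (fun x hx => ?_) fun _ _ _ => sq_nonneg _
    obtain ⟨w, hw, rfl⟩ := Finset.mem_image.mp hx
    rw [Finset.mem_range] at hw ⊢
    omega
  calc ‖f (v + m) - f v‖ ^ 2 ≤ m * ∑ w ∈ Finset.range m, ‖f (v + (w + 1)) - f (v + w)‖ ^ 2 := h1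
    _ ≤ N * ∑ w ∈ Finset.range N, ‖f (w + 1) - f w‖ ^ 2 :=
        mul_le_mul hmN h2 (Finset.sum_nonneg fun _ _ => sq_nonneg _) (Nat.cast_nonneg _)

/-- ★ **LINE SUP BOUND** (discrete Agmon on `[0, N]`): `(N+1) ‖f u‖² ≤ 2 Σ_{v ≤ N} ‖f v‖² + 2(N+1)N Σ_{w < N} ‖f (w+1) − f w‖²` — average
of `‖f u‖² ≤ 2‖f v‖² + 2‖f u − f v‖²` over the line. [this file, g57] -/
theorem lineSupBound (f : ℕ → E3) {N u : ℕ} (hu : u ≤ N) :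
    ((N : ℝ) + 1) * ‖f u‖ ^ 2 ≤ 2 * ∑ v ∈ Finset.range (N + 1), ‖f v‖ ^ 2 +
      2 * (((N : ℝ) + 1) * N) * ∑ w ∈ Finset.range N, ‖f (w + 1) - f w‖ ^ 2 := by
  have hpt : ∀ v ∈ Finset.range (N + 1),
      ‖f u‖ ^ 2 ≤ 2 * ‖f v‖ ^ 2 + 2 * ((N : ℝ) * ∑ w ∈ Finset.range N, ‖f (w + 1) - f w‖ ^ 2) := by
    intro v hv
    have hvN : v ≤ N := Nat.lt_succ_iff.mp (Finset.mem_range.mp hv)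
    have h1 : ‖f u‖ ^ 2 ≤ 2 * ‖f v‖ ^ 2 + 2 * ‖f u - f v‖ ^ 2 := by
      have := norm_add_sq_le_two (f v) (f u - f v)
      rwa [add_sub_cancel] at this
    have h2 := norm_sub_sq_le_of_le f hu hvN
    linarith
  have hsum := Finset.sum_le_sum hpt
  simp only [Finset.sum_add_distrib, Finset.sum_const, Finset.card_range, nsmul_eq_mul, Nat.cast_add, Nat.cast_one,
    ← Finset.mul_sum] at hsum
  linarith

/-! ### VD.2  Two and three dimensions: tensorisation on the box `[0, N]³` -/

/-- forward difference of a box function along the first index. -/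
def fd₁ (h : ℕ → ℕ → ℕ → E3) : ℕ → ℕ → ℕ → E3 := fun i j k => h (i + 1) j k - h i j k

/-- forward difference along the second index. -/
def fd₂ (h : ℕ → ℕ → ℕ → E3) : ℕ → ℕ → ℕ → E3 := fun i j k => h i (j + 1) k - h i j k

/-- forward difference along the third index. -/
def fd₃ (h : ℕ → ℕ → ℕ → E3) : ℕ → ℕ → ℕ → E3 := fun i j k => h i j (k + 1) - h i j k

/-- **PLANE SUP BOUND** (the `(1,2)`-slice at height `k`). [this file, g57] -/
theorem planeSupBound (h : ℕ → ℕ → ℕ → E3) {N i j : ℕ} (hi : i ≤ N) (hj : j ≤ N) (k : ℕ) :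
    ((N : ℝ) + 1) ^ 2 * ‖h i j k‖ ^ 2 ≤
      4 * ∑ j' ∈ Finset.range (N + 1), ∑ i' ∈ Finset.range (N + 1), ‖h i' j' k‖ ^ 2 +
      4 * (((N : ℝ) + 1) * N) * ∑ j' ∈ Finset.range (N + 1), ∑ i' ∈ Finset.range N, ‖fd₁ h i' j' k‖ ^ 2 +
      4 * (((N : ℝ) + 1) * N) * ∑ j' ∈ Finset.range N, ∑ i' ∈ Finset.range (N + 1), ‖fd₂ h i' j' k‖ ^ 2 +
      4 * (((N : ℝ) + 1) * N) ^ 2 * ∑ j' ∈ Finset.range N, ∑ i' ∈ Finset.range N, ‖fd₁ (fd₂ h) i' j' k‖ ^ 2 := by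
  have hN : (0 : ℝ) ≤ (N : ℝ) + 1 := by positivity
  have hM : (0 : ℝ) ≤ ((N : ℝ) + 1) * N := by positivity
  have hA : ((N : ℝ) + 1) * ‖h i j k‖ ^ 2 ≤ 2 * ∑ j' ∈ Finset.range (N + 1), ‖h i j' k‖ ^ 2 +
      2 * (((N : ℝ) + 1) * N) * ∑ j' ∈ Finset.range N, ‖fd₂ h i j' k‖ ^ 2 :=
    lineSupBound (fun j' => h i j' k) hj
  have hB := Finset.sum_le_sum fun j' (_ : j' ∈ Finset.range (N + 1)) => lineSupBound (fun i' => h i' j' k) hi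
  have hC := Finset.sum_le_sum fun j' (_ : j' ∈ Finset.range N) => lineSupBound (fun i' => fd₂ h i' j' k) hi
  simp only [Finset.sum_add_distrib, ← Finset.mul_sum] at hB hC
  have hB' : ((N : ℝ) + 1) * ∑ j' ∈ Finset.range (N + 1), ‖h i j' k‖ ^ 2 ≤
      2 * ∑ j' ∈ Finset.range (N + 1), ∑ i' ∈ Finset.range (N + 1), ‖h i' j' k‖ ^ 2 +
      2 * (((N : ℝ) + 1) * N) * ∑ j' ∈ Finset.range (N + 1), ∑ i' ∈ Finset.range N, ‖fd₁ h i' j' k‖ ^ 2 := hB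
  have hC' : ((N : ℝ) + 1) * ∑ j' ∈ Finset.range N, ‖fd₂ h i j' k‖ ^ 2 ≤
      2 * ∑ j' ∈ Finset.range N, ∑ i' ∈ Finset.range (N + 1), ‖fd₂ h i' j' k‖ ^ 2 +
      2 * (((N : ℝ) + 1) * N) * ∑ j' ∈ Finset.range N, ∑ i' ∈ Finset.range N, ‖fd₁ (fd₂ h) i' j' k‖ ^ 2 := hC
  have s1 : ((N : ℝ) + 1) ^ 2 * ‖h i j k‖ ^ 2 ≤ 2 * (((N : ℝ) + 1) * ∑ j' ∈ Finset.range (N + 1), ‖h i j' k‖ ^ 2) +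
      2 * (((N : ℝ) + 1) * N) * (((N : ℝ) + 1) * ∑ j' ∈ Finset.range N, ‖fd₂ h i j' k‖ ^ 2) := by
    have := mul_le_mul_of_nonneg_left hA hN
    linarith
  have s3 := mul_le_mul_of_nonneg_left hC' hM
  linarith

/-- summing the line bound along the third index over a rectangle of the `(1,2)`-plane. [formal bookkeeping] -/
theorem lineSupBound_sum₂ (g : ℕ → ℕ → ℕ → E3) {N k : ℕ} (hk : k ≤ N) (s t : Finset ℕ) :
    ((N : ℝ) + 1) * ∑ j' ∈ t, ∑ i' ∈ s, ‖g i' j' k‖ ^ 2 ≤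
      2 * ∑ j' ∈ t, ∑ i' ∈ s, ∑ k' ∈ Finset.range (N + 1), ‖g i' j' k'‖ ^ 2 +
      2 * (((N : ℝ) + 1) * N) * ∑ j' ∈ t, ∑ i' ∈ s, ∑ k' ∈ Finset.range N, ‖fd₃ g i' j' k'‖ ^ 2 := by
  have h1 := Finset.sum_le_sum fun j' (_ : j' ∈ t) =>
    Finset.sum_le_sum fun i' (_ : i' ∈ s) => lineSupBound (fun k' => g i' j' k') hk
  simp only [Finset.sum_add_distrib, ← Finset.mul_sum] at h1
  exact h1

/-- ★ **CUBE SUP BOUND** (dominating mixed smoothness on `[0, N]³`): `(N+1)³ ‖h i j k‖²` is at most `8 Σ_S ((N+1)N)^{|S|} Σ_box ‖Δ^S h‖²`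
over the eight subsets `S ⊆ {1, 2, 3}`, at most ONE difference per axis; the cross-index difference `fd₃` is always OUTERMOST. [this file, g57] -/
theorem cubeSupBound (h : ℕ → ℕ → ℕ → E3) {N i j k : ℕ} (hi : i ≤ N) (hj : j ≤ N) (hk : k ≤ N) :
    ((N : ℝ) + 1) ^ 3 * ‖h i j k‖ ^ 2 ≤
      8 * (∑ j' ∈ Finset.range (N + 1), ∑ i' ∈ Finset.range (N + 1), ∑ k' ∈ Finset.range (N + 1), ‖h i' j' k'‖ ^ 2
        + (((N : ℝ) + 1) * N) *
          (∑ j' ∈ Finset.range (N + 1), ∑ i' ∈ Finset.range N, ∑ k' ∈ Finset.range (N + 1), ‖fd₁ h i' j' k'‖ ^ 2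
            + ∑ j' ∈ Finset.range N, ∑ i' ∈ Finset.range (N + 1), ∑ k' ∈ Finset.range (N + 1), ‖fd₂ h i' j' k'‖ ^ 2
            + ∑ j' ∈ Finset.range (N + 1), ∑ i' ∈ Finset.range (N + 1), ∑ k' ∈ Finset.range N, ‖fd₃ h i' j' k'‖ ^ 2)
        + (((N : ℝ) + 1) * N) ^ 2 *
          (∑ j' ∈ Finset.range N, ∑ i' ∈ Finset.range N, ∑ k' ∈ Finset.range (N + 1), ‖fd₁ (fd₂ h) i' j' k'‖ ^ 2
            + ∑ j' ∈ Finset.range (N + 1), ∑ i' ∈ Finset.range N, ∑ k' ∈ Finset.range N, ‖fd₃ (fd₁ h) i' j' k'‖ ^ 2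
            + ∑ j' ∈ Finset.range N, ∑ i' ∈ Finset.range (N + 1), ∑ k' ∈ Finset.range N, ‖fd₃ (fd₂ h) i' j' k'‖ ^ 2)
        + (((N : ℝ) + 1) * N) ^ 3 *
          ∑ j' ∈ Finset.range N, ∑ i' ∈ Finset.range N, ∑ k' ∈ Finset.range N, ‖fd₃ (fd₁ (fd₂ h)) i' j' k'‖ ^ 2) := by
  have hN : (0 : ℝ) ≤ (N : ℝ) + 1 := by positivity
  have hM : (0 : ℝ) ≤ ((N : ℝ) + 1) * N := by positivity
  have hP := planeSupBound h hi hj k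
  have t0 := lineSupBound_sum₂ h hk (Finset.range (N + 1)) (Finset.range (N + 1))
  have t1 := lineSupBound_sum₂ (fd₁ h) hk (Finset.range N) (Finset.range (N + 1))
  have t2 := lineSupBound_sum₂ (fd₂ h) hk (Finset.range (N + 1)) (Finset.range N)
  have t12 := lineSupBound_sum₂ (fd₁ (fd₂ h)) hk (Finset.range N) (Finset.range N)
  have s1 : ((N : ℝ) + 1) ^ 3 * ‖h i j k‖ ^ 2 ≤
      4 * (((N : ℝ) + 1) * ∑ j' ∈ Finset.range (N + 1), ∑ i' ∈ Finset.range (N + 1), ‖h i' j' k‖ ^ 2) +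
      4 * (((N : ℝ) + 1) * N) * (((N : ℝ) + 1) * ∑ j' ∈ Finset.range (N + 1), ∑ i' ∈ Finset.range N, ‖fd₁ h i' j' k‖ ^ 2) +
      4 * (((N : ℝ) + 1) * N) * (((N : ℝ) + 1) * ∑ j' ∈ Finset.range N, ∑ i' ∈ Finset.range (N + 1), ‖fd₂ h i' j' k‖ ^ 2) +
      4 * (((N : ℝ) + 1) * N) ^ 2 *
        (((N : ℝ) + 1) * ∑ j' ∈ Finset.range N, ∑ i' ∈ Finset.range N, ‖fd₁ (fd₂ h) i' j' k‖ ^ 2) := by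
    have := mul_le_mul_of_nonneg_left hP hN
    linarith
  have u1 := mul_le_mul_of_nonneg_left t1 hM
  have u2 := mul_le_mul_of_nonneg_left t2 hM
  have u12 := mul_le_mul_of_nonneg_left t12 (pow_nonneg hM 2)
  linarith

end MixedSup

end Summit.AtomisticToContinuum.Crystallization.Theorems.ChartedZeroExcessLayeredLatticeLiouville
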